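import Summits.BirchSwinnertonDyer.BirchSwinnertonDyer.Theorems.ThetaPartnerAtTwoSignedControlAtTwoPlusGenBridgeTwo
import Summits.BirchSwinnertonDyer.BirchSwinnertonDyer.Theorems.PrintX8VSInputHondaSystemSprungHondaIso
import Summits.BirchSwinnertonDyer.BirchSwinnertonDyer.Theorems.PrintX8VSInputHondaSystemSprungLogValues
import HarnessLib

/-!
# Sprung's Honda system AT `p = 2`, V: KOBAYASHI'S GENERATION STEP ALONG THE PLUS TOWER for SPRUNG's logarithm
# (type `2 − aT + T²`, ANY even `a`) — TP2's `PlusTower.exists_sub_closure_sub_two_smul_plus` with its single `a₂ = 0` input replaced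

Seat `bsd-2adic-tower-1` GEN 66, hand H2-C1 (pen GEN 40 SUMMON 20260831T155847Z): the `a₂ = ±2` rows of (C1)
`F1Sign2.HondaSystemAtTwoExists` (crux `SupersingularRankZeroAtTwo`, item stmt-BirchSwinnertonDyer-19097). Sequel of
`…HondaSystemAtTwoSprungIso` (IV).

WHY. TP2's generation step along the plus tower `ℚ₂(v_{N+1}) ⊃ ℚ₂(v_N)` (`SignedEC.PlusTower.exists_sub_closure_sub_two_smul_plus`,
K4 line `eulerchar`, HONDA⁺@2) is a₂-free EXCEPT for one line: «Prop. 8.11⁺» `Λ(E₁(k')) ⊆ k + 𝒪_{k'}` is obtained there from Kobayashi's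
logarithm of type `T² + 2` through `exists_mem_norm_ptLog_sub_le_one' htr` (`htr : a₂(M) = 0`). For a general even `a₂` the same
inclusion follows from SPRUNG's logarithm `ℓ(X) = ∑ₖ x_k((1+X)^{2^k} − 1)` (`‖x_k‖ ≤ √2^k`) and ANY integral Honda pair `(i, j)` with
`log_E ∘ i = ℓ` (file IV): the congruence form `ℓ(𝔪_{k'}) ⊆ k + 𝒪_{k'}` is `SprungHonda.exists_mem_norm_qEval_sprungLog_sub_le_one` (the
Frobenius hypothesis being TP2's FROB⁺ `exists_norm_sq_sub_le`), and `Λ(P) = ℓ(y_P)` for the Honda parameter is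
`SprungHonda.exists_mem_norm_ptLog_sub_le_one_of_forall`. Everything else — TGEN (`exists_mem_closure_pow_sigma_add`), local surjectivity
(`exists_ptLog_eq`), the closure correspondence (`exists_closure_pt_plus`) — is copied VERBATIM.

WHAT (THEOREMS ONLY; no definition, no named fact, no instance, no `sorry`; route-independent):
* `SignedEC.PlusTower.exists_sub_closure_sub_two_smul_plus_sprung` — the log-level step for the Sprung data `(x, i, j)`;
* `SignedEC.PlusLayer.plusGen_kernel_two_sprung` — the (GEN) clause at level `n ≥ 1` on `E₁` with generator `toLoc e` in the
  `localLayerPointsOfEmb κ ι W` currency (TP2's `plusGen_kernel_two` with the same replacement).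
HONEST FRAMING: local theory at `2`; closes no item; BSD is not proved by any of this.

References: [Kobayashi2003] S. Kobayashi, Invent. Math. 152 (2003), Props. 8.11–8.12; [Sprung2012] F. Sprung, J. Number Theory 132
(2012), Thm. 2.2, Lemmas 7.4–7.5; [Washington1997] §13.1.
-/

set_option autoImplicit false
-- the Theorems namespace of this sub repeats the summit name by design (D-0017 nested layout)
set_option linter.dupNamespace false

noncomputable section

open scoped Classical Topology NNReal IntermediateField
open Filter PowerSeries Finset Polynomial

namespace Summit.BirchSwinnertonDyer.BirchSwinnertonDyer.Theorems.SignedEC.PlusTower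

open Literature.RingTheory.FormalGroups WeierstrassCurve Field Field.absoluteGaloisGroup
open Summit.BirchSwinnertonDyer.Rank1Residual.Additive
open Summit.BirchSwinnertonDyer.Rank1Residual.Additive.PadicCyclotomicTower
open Summit.BirchSwinnertonDyer.Rank1Residual.Additive.HondaFss
open Summit.BirchSwinnertonDyer.Rank1Residual.Additive.BallEval
open Literature.NumberTheory.GaloisRepresentations.LubinTate (unitBall mem_unitBall_iff)
open Literature.NumberTheory.EllipticCurves Literature.NumberTheory.EllipticCurves.FormalGroupChart
open Summit.BirchSwinnertonDyer.BirchSwinnertonDyer.Theorems.SignedKatoOffTwo.LocalAllPrimes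
open Summit.BirchSwinnertonDyer.BirchSwinnertonDyer.Theorems.SignedEC.OmegaSubfield

/-! ## §1 The generation step along the plus tower (log level), Sprung data -/

section Generation

variable {M : WeierstrassCurve ℤ_[2]} [hE : (M.map PadicInt.Coe.ringHom).IsElliptic]
  [hintΩ : (genFibΩ 2 M).IsIntegral (Valued.v (R := PadicAlgCl 2)).integer]

/-- **KOBAYASHI'S GENERATION STEP ALONG THE PLUS TOWER AT `p = 2` for SPRUNG's logarithm (log level).** `M/ℤ₂` with elliptic
fibres, `N ≥ 2`, `k = ℚ₂(v_N) ⊂ k' = ℚ₂(v_{N+1})`; Sprung data: `x` with `‖x_k‖ ≤ √2^k` and an integral Honda pair `(i, j)` with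
`i ∘ j = X`, `log_E ∘ i = ℓ_x`; `e ∈ L(k') ∩ E₁` with `Λ(e) − v_{N+1} ∈ k`; `P ∈ L(k') ∩ E₁`. Then there are `B ∈ ℤ[Γ·e]` and
`R ∈ L(k') ∩ E₁` with `P − B − 2•R ∈ L(k') ∩ E₁` and `Λ(P − B − 2•R) ∈ k`. Verbatim TP2's `exists_sub_closure_sub_two_smul_plus` except
(BR1), which is `SprungHonda.exists_mem_norm_ptLog_sub_le_one_of_forall` ∘ `…exists_mem_norm_qEval_sprungLog_sub_le_one` (FROB⁺ as there).
[cite: Kobayashi2003, Prop. 8.11, Prop. 8.12] [cite: Sprung2012, Thm. 2.2, Lemmas 7.4–7.5] -/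
theorem exists_sub_closure_sub_two_smul_plus_sprung
    {x : ℕ → ℚ_[2]} (hxb : ∀ k, ‖x k‖ ≤ Real.sqrt 2 ^ k) {i j : ℤ_[2]⟦X⟧}
    (hi0 : constantCoeff i = 0) (hj0 : constantCoeff j = 0) (hij : i.subst j = PowerSeries.X)
    (hlog : (M.map (PadicInt.Coe.ringHom (p := 2))).formalLog.subst (i.map PadicInt.Coe.ringHom) =
      PowerSeries.mk fun d ↦ ∑' k : ℕ, x k * (((2 ^ k).choose d : ℚ_[2]) - if d = 0 then 1 else 0))
    (act : absoluteGaloisGroup ℚ_[2] → (genFibΩ 2 M).toAffine.Point → (genFibΩ 2 M).toAffine.Point)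
    (hact0 : ∀ σ, act σ 0 = 0)
    (hact : ∀ σ (x y : PadicAlgCl 2) (h : (genFibΩ 2 M).toAffine.Nonsingular x y),
      ∃ h', act σ (Affine.Point.some x y h) = Affine.Point.some (σ • x) (σ • y) h')
    {N : ℕ} (hN : 2 ≤ N) {e : (genFibΩ 2 M).toAffine.Point}
    (heL : e ∈ subfieldPoints (genFibΩ 2 M) (ℚ_[2]⟮zeta 2 (N + 1) + (zeta 2 (N + 1))⁻¹ - 2⟯).toSubfield
      (coeffs_mem_adjoin M _))
    (hek : e ∈ kernel (Valued.v (R := PadicAlgCl 2)) (genFibΩ 2 M))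
    (heℓ : ptLogΩ 2 M e - (zeta 2 (N + 1) + (zeta 2 (N + 1))⁻¹ - 2) ∈ ℚ_[2]⟮zeta 2 N + (zeta 2 N)⁻¹ - 2⟯)
    {P : (genFibΩ 2 M).toAffine.Point}
    (hP : P ∈ subfieldPoints (genFibΩ 2 M) (ℚ_[2]⟮zeta 2 (N + 1) + (zeta 2 (N + 1))⁻¹ - 2⟯).toSubfield
      (coeffs_mem_adjoin M _))
    (hPk : P ∈ kernel (Valued.v (R := PadicAlgCl 2)) (genFibΩ 2 M)) :
    ∃ B ∈ AddSubgroup.closure (Set.range fun σ : absoluteGaloisGroup ℚ_[2] ↦ act σ e),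
      ∃ R ∈ subfieldPoints (genFibΩ 2 M) (ℚ_[2]⟮zeta 2 (N + 1) + (zeta 2 (N + 1))⁻¹ - 2⟯).toSubfield
          (coeffs_mem_adjoin M _),
        R ∈ kernel (Valued.v (R := PadicAlgCl 2)) (genFibΩ 2 M) ∧
        P - B - 2 • R ∈ subfieldPoints (genFibΩ 2 M) (ℚ_[2]⟮zeta 2 (N + 1) + (zeta 2 (N + 1))⁻¹ - 2⟯).toSubfield
          (coeffs_mem_adjoin M _) ∧
        P - B - 2 • R ∈ kernel (Valued.v (R := PadicAlgCl 2)) (genFibΩ 2 M) ∧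
        ptLogΩ 2 M (P - B - 2 • R) ∈ ℚ_[2]⟮zeta 2 N + (zeta 2 N)⁻¹ - 2⟯ := by
  set v := zeta 2 N + (zeta 2 N)⁻¹ - 2 with hv
  set v' := zeta 2 (N + 1) + (zeta 2 (N + 1))⁻¹ - 2 with hv'
  set k := ℚ_[2]⟮v⟯ with hk
  set k' := ℚ_[2]⟮v'⟯ with hk'
  haveI : FiniteDimensional ℚ_[2] (↥k') :=
    IntermediateField.adjoin.finiteDimensional (Algebra.IsIntegral.isIntegral v')
  haveI := isIntegral_curveK 2 (OmegaSubfield 2 k') M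
  haveI := isIntegral_curveK 2 (LayerField 2 (N + 1)) M
  have hle : k'.toSubfield ≤ (layer 2 (N + 1)).toSubfield := adjoin_v_le_layer (N + 1)
  have hkk' : k ≤ k' := adjoin_v_le_adjoin_v_succ N
  -- lift `P` to the complete field `K = OmegaSubfield 2 k'`
  obtain ⟨PK, rfl⟩ := exists_toOmegaF_eq hP
  have hPKk : PK ∈ kernel (NormedField.valuation (K := OmegaSubfield 2 k')) (curveK 2 (OmegaSubfield 2 k') M) :=
    (toOmegaF_mem_kernel_iff PK).mp hPk
  -- (BR1) `Λ(P) = μ₀ + y`, `μ₀ ∈ k`, `‖y‖ ≤ 1` — Honda at every prime + FROB⁺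
  set K' : Subfield (OmegaSubfield 2 k') := Subfield.comap (emb 2 k').toRingHom k.toSubfield with hK'
  have hFrob : ∀ y : OmegaSubfield 2 k', ‖y‖ ≤ 1 →
      ∃ s ∈ K', ‖s‖ ≤ 1 ∧ ‖y ^ 2 - s‖ ≤ ‖((2 : ℕ) : OmegaSubfield 2 k')‖ := by
    intro y hy
    rw [← norm_emb] at hy
    obtain ⟨s, hsk, hs1, hys⟩ := exists_norm_sq_sub_le hN (emb_mem y) hy
    refine ⟨mk 2 k' s (hkk' hsk), ?_, ?_, ?_⟩
    · change emb 2 k' (mk 2 k' s (hkk' hsk)) ∈ k.toSubfield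
      rw [emb_mk]; exact hsk
    · rw [← norm_emb, emb_mk]; exact hs1
    · rw [← norm_emb, map_sub, map_pow, emb_mk, ← norm_emb (p := 2) (F := k') ((2 : ℕ) : OmegaSubfield 2 k'), map_natCast]
      exact_mod_cast hys
  -- Prop. 8.11⁺ for SPRUNG's logarithm: the congruence form of `ℓ` (any `a`) + Honda's points for the pair `(i, j)`
  have hK'alg : ∀ q : ℚ_[2], algebraMap ℚ_[2] (OmegaSubfield 2 k') q ∈ K' := fun q ↦ by
    change emb 2 k' (algebraMap ℚ_[2] (OmegaSubfield 2 k') q) ∈ k.toSubfield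
    rw [AlgHom.commutes]
    exact k.algebraMap_mem q
  have hcongr : ∀ y : OmegaSubfield 2 k', ‖y‖ < 1 → ∃ μ ∈ K', ‖qEval 2 (OmegaSubfield 2 k')
      (PowerSeries.mk fun d ↦ ∑' k : ℕ, x k * (((2 ^ k).choose d : ℚ_[2]) - if d = 0 then 1 else 0)) y - μ‖ ≤ 1 :=
    fun y hy ↦ SprungHonda.exists_mem_norm_qEval_sprungLog_sub_le_one hxb K' hK'alg hFrob hy
  obtain ⟨μ₀, hμ₀, hμ₀y⟩ := SprungHonda.exists_mem_norm_ptLog_sub_le_one_of_forall hi0 hj0 hij hlog K' hcongr hPKk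
  set y : OmegaSubfield 2 k' := ptLog 2 (OmegaSubfield 2 k') M PK - μ₀ with hy
  have hμ₀k : emb 2 k' μ₀ ∈ k := hμ₀
  have hy1 : ‖emb 2 k' y‖ ≤ 1 := by rw [norm_emb]; exact hμ₀y
  -- (DEC) `y = z + ν + 2³ y'` — TGEN, from the tower lemma `(T)`
  obtain ⟨σ₃, hσ₃⟩ := exists_sigma_three (by omega : 1 ≤ N + 1)
  obtain ⟨z, hz, ν, ⟨hνk, -⟩, y'Ω, ⟨hy'L, hy'1⟩, hdec⟩ :=
    exists_mem_closure_pow_sigma_add hN hσ₃ 3 (emb_mem y) hy1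
  have hz' : z ∈ AddSubgroup.closure (Set.range fun σ : absoluteGaloisGroup ℚ_[2] ↦ σ • v') := by
    refine AddSubgroup.closure_mono ?_ hz
    rintro _ ⟨i, rfl⟩
    refine ⟨(toAlgEquiv ℚ_[2]).symm (σ₃ ^ i), ?_⟩
    change ((toAlgEquiv ℚ_[2]).symm (σ₃ ^ i)) • v' = (σ₃ ^ i) v'
    rw [absoluteGaloisGroup.smul_def, MulEquiv.apply_symm_apply]
  -- local surjectivity: `2³ y' = Λ(2 • RK)` in `K`
  set y'K : OmegaSubfield 2 k' := mk 2 k' y'Ω hy'L with hy'K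
  have h2 : ‖(2 : OmegaSubfield 2 k')‖ = 2⁻¹ := by
    rw [← norm_emb, map_ofNat, ← map_ofNat (algebraMap ℚ_[2] (PadicAlgCl 2)) 2, PadicAlgCl.norm_extends]
    have := Padic.norm_p (p := 2)
    exact_mod_cast this
  have htarget : ‖(2 : OmegaSubfield 2 k') ^ 2 * y'K‖ ≤ 1 / 4 := by
    rw [norm_mul, norm_pow, h2]
    have hy'n : ‖y'K‖ ≤ 1 := by rw [hy'K, ← norm_emb, emb_mk]; exact hy'1
    calc (2⁻¹ : ℝ) ^ 2 * ‖y'K‖ ≤ (2⁻¹ : ℝ) ^ 2 * 1 := by gcongr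
      _ = 1 / 4 := by norm_num
  obtain ⟨RK, hRKk, hΛR, -⟩ := exists_ptLog_eq (p := 2) (M := M) htarget
  have hΛpR : ptLog 2 (OmegaSubfield 2 k') M (2 • RK) = (2 : OmegaSubfield 2 k') ^ 3 * y'K := by
    rw [ptLog_nsmul hRKk, hΛR]; push_cast; ring
  -- the `Γ`-combination of conjugates of `e`
  obtain ⟨B, hB, hBL, hBk, hBz⟩ := exists_closure_pt_plus act hact0 hact hN heL hek heℓ hz'
  set νB := ptLogΩ 2 M B - z with hνB
  -- assemble
  set R := toOmega 2 k' M RK with hR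
  have hRL : R ∈ subfieldPoints (genFibΩ 2 M) k'.toSubfield (coeffs_mem_adjoin M _) := toOmegaF_mem_subfieldPoints RK
  have hRk : R ∈ kernel (Valued.v (R := PadicAlgCl 2)) (genFibΩ 2 M) := (toOmegaF_mem_kernel_iff RK).mpr hRKk
  have hPL : toOmega 2 k' M PK ∈ subfieldPoints (genFibΩ 2 M) k'.toSubfield (coeffs_mem_adjoin M _) :=
    toOmegaF_mem_subfieldPoints PK
  have hPRL : toOmega 2 k' M PK - B - 2 • R ∈ subfieldPoints (genFibΩ 2 M) k'.toSubfield (coeffs_mem_adjoin M _) :=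
    (subfieldPoints _ _ _).sub_mem ((subfieldPoints _ _ _).sub_mem hPL hBL) ((subfieldPoints _ _ _).nsmul_mem hRL _)
  have hpRk : 2 • R ∈ kernel (Valued.v (R := PadicAlgCl 2)) (genFibΩ 2 M) :=
    (kernel (Valued.v (R := PadicAlgCl 2)) (genFibΩ 2 M)).nsmul_mem hRk _
  have hPRk : toOmega 2 k' M PK - B - 2 • R ∈ kernel (Valued.v (R := PadicAlgCl 2)) (genFibΩ 2 M) :=
    (kernel (Valued.v (R := PadicAlgCl 2)) (genFibΩ 2 M)).sub_mem
      ((kernel (Valued.v (R := PadicAlgCl 2)) (genFibΩ 2 M)).sub_mem hPk hBk) hpRk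
  refine ⟨B, hB, R, hRL, hRk, hPRL, hPRk, ?_⟩
  -- the logarithm of `P − B − 2•R`
  have hΛP : ptLogΩ 2 M (toOmega 2 k' M PK) = emb 2 k' μ₀ + emb 2 k' y := by
    rw [ptLogΩ_toOmegaF hPKk, hy, ← map_add]; congr 1; ring
  have hΛpR' : ptLogΩ 2 M (2 • R) = (2 : PadicAlgCl 2) ^ 3 * y'Ω := by
    rw [hR, ← map_nsmul, ptLogΩ_toOmegaF ((kernel (NormedField.valuation (K := OmegaSubfield 2 k'))
      (curveK 2 (OmegaSubfield 2 k') M)).nsmul_mem hRKk _), hΛpR, map_mul, map_pow, map_ofNat, hy'K, emb_mk]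
  rw [ptLogΩ_sub (m := N + 1) (mem_subfieldPoints_of_le _ coeffs_mem_layer hle ((subfieldPoints _ _ _).sub_mem hPL hBL))
      (mem_subfieldPoints_of_le _ coeffs_mem_layer hle ((subfieldPoints _ _ _).nsmul_mem hRL _))
      ((kernel (Valued.v (R := PadicAlgCl 2)) (genFibΩ 2 M)).sub_mem hPk hBk) hpRk,
    ptLogΩ_sub (m := N + 1) (mem_subfieldPoints_of_le _ coeffs_mem_layer hle hPL)
      (mem_subfieldPoints_of_le _ coeffs_mem_layer hle hBL) hPk hBk, hΛP, hΛpR']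
  have eB : ptLogΩ 2 M B = z + νB := by rw [hνB]; ring
  rw [eB]
  have e : emb 2 k' μ₀ + emb 2 k' y - (z + νB) - (2 : PadicAlgCl 2) ^ 3 * y'Ω =
      emb 2 k' μ₀ + ν - νB + (emb 2 k' y - (z + ν + 2 ^ 3 * y'Ω)) := by ring
  rw [e, ← hdec, sub_self, add_zero]
  exact IntermediateField.sub_mem _ (IntermediateField.add_mem _ hμ₀k hνk) hBz

end Generation

end Summit.BirchSwinnertonDyer.BirchSwinnertonDyer.Theorems.SignedEC.PlusTower

/-! ## §2 The (GEN) clause on `E₁` in the layer currency, Sprung data -/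

namespace Summit.BirchSwinnertonDyer.BirchSwinnertonDyer.Theorems.SignedEC.PlusLayer

open Field WeierstrassCurve Literature.NumberTheory.EllipticCurves Literature.NumberTheory.GaloisRepresentations
  Literature.NumberTheory.EllipticCurves.ZpExtension Literature.NumberTheory.EllipticCurves.Kobayashi2003
  Literature.NumberTheory.EllipticCurves.FormalGroupChart
  Summit.BirchSwinnertonDyer.Rank1Residual.Additive Summit.BirchSwinnertonDyer.Rank1Residual.Additive.PadicCyclotomicTower
  Summit.BirchSwinnertonDyer.Rank1Residual.Additive.BallEval

section Bridge

variable {M : WeierstrassCurve ℤ_[2]} [hE : (M.map PadicInt.Coe.ringHom).IsElliptic]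
  [hintΩ : (genFibΩ 2 M).IsIntegral (Valued.v (R := PadicAlgCl 2)).integer]
  {W : WeierstrassCurve ℚ} (hV : genFibΩ 2 M = W.baseChange (AlgebraicClosure ℚ_[2]))
  {κ : ZpExtension ℚ 2} (ι : AlgebraicClosure ℚ →ₐ[ℚ] PadicAlgCl 2)

/-- **The (GEN) clause at level `n ≥ 1` on `E₁`, with generator `toLoc e`, for SPRUNG data** — TP2's `plusGen_kernel_two` with
its `a₂ = 0` input replaced by the Sprung pair `(i, j)`: a plus Honda point `e ∈ E₁(ℚ₂(v_{n+2}))` with `Λ e ≡ v_{n+2} (mod ℚ₂(v_{n+1}))`,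
no `2`-power torsion in `L(n+2)`; for every `P ∈ E₁` with `toLoc P ∈ E(ℚ_{2,n}·ℚ₂)`: `toLoc P = B + P' + 2•R`, `B ∈ ℤ[Γ_{ℚ₂}]·toLoc e`,
`P' ∈ E(ℚ_{2,n−1}·ℚ₂)`, `R ∈ E(ℚ_{2,n}·ℚ₂)`. [cite: Kobayashi2003, Prop. 8.11, Prop. 8.12] -/
theorem plusGen_kernel_two_sprung (hκ : κ.IsCyclotomic)
    {x : ℕ → ℚ_[2]} (hxb : ∀ k, ‖x k‖ ≤ Real.sqrt 2 ^ k) {i j : ℤ_[2]⟦X⟧}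
    (hi0 : constantCoeff i = 0) (hj0 : constantCoeff j = 0) (hij : i.subst j = PowerSeries.X)
    (hlog : (M.map (PadicInt.Coe.ringHom (p := 2))).formalLog.subst (i.map PadicInt.Coe.ringHom) =
      PowerSeries.mk fun d ↦ ∑' k : ℕ, x k * (((2 ^ k).choose d : ℚ_[2]) - if d = 0 then 1 else 0))
    {n : ℕ} (hn : 1 ≤ n)
    (htors : ∀ Q ∈ subfieldPoints (genFibΩ 2 M) (layer 2 (n + 2)).toSubfield coeffs_mem_layer,
      ∀ k : ℕ, 2 ^ k • Q = 0 → Q = 0)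
    {e : (genFibΩ 2 M).toAffine.Point}
    (heL : e ∈ subfieldPoints (genFibΩ 2 M) (ℚ_[2]⟮zeta 2 (n + 2) + (zeta 2 (n + 2))⁻¹ - 2⟯).toSubfield
      (PlusTower.coeffs_mem_adjoin M _))
    (hek : e ∈ kernel (Valued.v (R := PadicAlgCl 2)) (genFibΩ 2 M))
    (heℓ : ptLogΩ 2 M e - (zeta 2 (n + 2) + (zeta 2 (n + 2))⁻¹ - 2) ∈ ℚ_[2]⟮zeta 2 (n + 1) + (zeta 2 (n + 1))⁻¹ - 2⟯)
    {P : (genFibΩ 2 M).toAffine.Point} (hPk : P ∈ kernel (Valued.v (R := PadicAlgCl 2)) (genFibΩ 2 M))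
    (hPn : toLoc hV P ∈ localLayerPointsOfEmb κ ι W n) :
    ∃ B ∈ AddSubgroup.closure (Set.range fun σ : absoluteGaloisGroup ℚ_[2] ↦ σ • toLoc hV e),
      ∃ P' ∈ localLayerPointsOfEmb κ ι W (n - 1), ∃ R ∈ localLayerPointsOfEmb κ ι W n,
        toLoc hV P = B + P' + 2 • R := by
  obtain ⟨n', rfl⟩ := Nat.exists_eq_add_of_le' hn
  -- `P` has coordinates in the plus field `k' = ℚ₂(v_{n+2})`
  have hPL' := (mem_localLayerPointsOfEmb_two_iff_mem_subfieldPoints_adjoin_v hV ι hκ (n' + 1) (toLoc hV P)).mp hPn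
  rw [AddEquiv.symm_apply_apply] at hPL'
  obtain ⟨B, hB, R, hRL, hRk, hDL, hDk, hDℓ⟩ := PlusTower.exists_sub_closure_sub_two_smul_plus_sprung (M := M) hxb hi0 hj0 hij hlog
    (fun σ Q ↦ (toLoc hV).symm (σ • toLoc hV Q)) (act_zero hV) (act_some hV) (N := n' + 2) (by omega)
    (by simpa using heL) hek (by simpa using heℓ) (by simpa using hPL') hPk
  -- descent of `P − B − 2•R` to layer `n − 1 = n'` (part IV (D1)), via coordinates in `ℚ₂(ζ_{2^{n+2}})`
  have hle : ℚ_[2]⟮zeta 2 (n' + 2 + 1) + (zeta 2 (n' + 2 + 1))⁻¹ - 2⟯ ≤ layer 2 (n' + 1 + 2) := by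
    rw [show n' + 2 + 1 = n' + 1 + 2 by ring]; exact PlusTower.adjoin_v_le_layer _
  have hDL2 : P - B - 2 • R ∈ subfieldPoints (genFibΩ 2 M) (layer 2 (n' + 1 + 2)).toSubfield coeffs_mem_layer :=
    PlusTower.mem_subfieldPoints_of_le _ _ hle hDL
  have hRL2 : R ∈ subfieldPoints (genFibΩ 2 M) (layer 2 (n' + 1 + 2)).toSubfield coeffs_mem_layer :=
    PlusTower.mem_subfieldPoints_of_le _ _ hle hRL
  have hDℓ' : ptLogΩ 2 M (P - B - 2 • R) ∈ ℚ_[2]⟮zeta 2 (n' + 2) + (zeta 2 (n' + 2))⁻¹⟯ := by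
    rw [adjoin_u_eq_adjoin_v]; exact hDℓ
  have hdesc : toLoc hV (P - B - 2 • R) ∈ localLayerPointsOfEmb κ ι W n' :=
    toLoc_mem_localLayerPointsOfEmb_of_ptLogΩ_mem hV ι hκ htors hDL2 hDk hDℓ'
  -- `R ∈ E(k')`: its coordinates lie in the plus field
  have hRn : toLoc hV R ∈ localLayerPointsOfEmb κ ι W (n' + 1) := by
    rw [mem_localLayerPointsOfEmb_two_iff_mem_subfieldPoints_adjoin_v hV ι hκ (n' + 1), AddEquiv.symm_apply_apply]
    simpa using hRL
  refine ⟨toLoc hV B, ?_, toLoc hV (P - B - 2 • R), by simpa using hdesc, toLoc hV R, hRn, ?_⟩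
  · rw [← map_closure_range_act_eq hV e]
    exact ⟨B, hB, rfl⟩
  · simp only [map_sub, map_nsmul]
    abel

end Bridge

end Summit.BirchSwinnertonDyer.BirchSwinnertonDyer.Theorems.SignedEC.PlusLayer

end
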